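import Summits.BirchSwinnertonDyer.BirchSwinnertonDyer.Theorems.EisensteinPrimesWeakLeopoldtAboveCurve
import Summits.BirchSwinnertonDyer.BirchSwinnertonDyer.Theorems.EisensteinPrimesAcTwistDeformationCurveSUROfTateTC
import Summits.BirchSwinnertonDyer.BirchSwinnertonDyer.Theorems.EisensteinPrimesWeakLeopoldtAboveOfTateTC
import Literature.NumberTheory.IwasawaTheory.Greenberg2006.CohomologyCofiniteGenerationLeTwoOfTateTC
import HarnessLib

/-!
# T28b re-typing (`OfTateTC`: Tate's formula by name AT TOTALLY COMPLEX FIELDS) of `EisensteinPrimesWeakLeopoldtAboveCurve.lean`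

Route `EisensteinPrimes` (rung K5), crux 2 `GoodLatticeBDPValue` (stmt-BirchSwinnertonDyer-19032), line `halves`;
cell `bsd-eis`, seat `bsd-line-x1-p1` LEAD g8, lane «T28 / TATE RE-PLUMB» (helper, `--supports`).

This file re-types, token for token, the theorems of `EisensteinPrimesWeakLeopoldtAboveCurve` that carry
Greenberg 2006 Prop. 3.2 BY NAME (`h32 : (∀ (L : Type) [Field L] [NumberField L] [IsTotallyComplex L], Literature.NumberTheory.GaloisCohomology.tateGlobalEulerPoincareCharacteristic L)`, cofinite generation of
`Hⁱ(K_Σ/K, 𝒟)` / `Hⁱ(K_v, 𝒟)` for EVERY `i`, every number field, every prime) with that hypothesis replaced by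
Tate's global Euler–Poincaré characteristic BY NAME AT TOTALLY COMPLEX FIELDS
(`h32 : ∀ L [IsTotallyComplex L], GaloisCohomology.tateGlobalEulerPoincareCharacteristic L`, Milne ADT I Thm. 5.1 — the shape the
tree's class-formation road to Tate's theorem delivers; where a theorem's field was not syntactically totally complex an
`[IsTotallyComplex K]` binder is added and supplied by its callers from `IsImaginaryQuadratic K` / `∀ w, w.IsComplex`): on this line
Prop. 3.2 is read in degrees `i ≤ 2` only (global clause; the local clause is the unconditional
`Greenberg2006.prop32_local_holds`), and in those degrees it follows from Tate's formula alone
(`Greenberg2006.prop32_global_le_two_of_tate_tc`, file `CohomologyCofiniteGenerationLeTwoOfTateTC`: `H⁰`/`H¹` of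
`G_{K,S}` with finite coefficients are finite unconditionally, `H²` by Tate, and Greenberg's dévissage for `Hⁿ`
involves `Hⁿ`, `Hⁿ⁻¹` only).  Statements are otherwise VERBATIM (same binder order, new names `<name>_ofTateTC`; supersedes this seat's `…OfTate` twin, which took Tate's formula at every number field);
proofs are the tree proofs with the two reading lemmas substituted and the re-typed callees called.
EFFECT for the crux: Harari Thm. 17.13 (a) (`poitouTate_restricted_three_le`) is no longer consumed through
Prop. 3.2 at every number field, only at totally complex fields (Greenberg 2006 Prop. 4.1 is typed totally
imaginary; `cd_p ≤ 2` and the `H²` bookkeeping at the imaginary quadratic `K`), which is what the tree's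
class-formation road (`RestrictedRamificationCdTwoOfH3Mu`, lane PT3-TC) proves.

Theorems only; no definition, no named fact, no `sorry`, no instance. HONEST FRAMING: conditional on the PUBLISHED
named facts carried as hypotheses; closes nothing by itself; no summit statement / BSD / the crux is proved here.

## References
* R. Greenberg, *On the structure of certain Galois cohomology groups*, Doc. Math. Extra Vol. Coates (2006), Prop. 3.2 (p. 358). [Greenberg2006]
* J. S. Milne, *Arithmetic Duality Theorems*, 2nd ed. (2006), I Thm. 5.1 (p. 67). [MilneADT2006]
* (the references of the re-typed file apply verbatim)
-/

set_option autoImplicit false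

noncomputable section

open scoped Classical
open NumberField IsDedekindDomain Field Multiplicative WeierstrassCurve
open Literature.NumberTheory.EllipticCurves Literature.NumberTheory.EllipticCurves.GreenbergSelmer
  Literature.NumberTheory.EllipticCurves.GreenbergVatsal2000 Literature.NumberTheory.GaloisRepresentations
  Literature.NumberTheory.GaloisCohomology
  Literature.NumberTheory.EllipticCurves.KellerYin2024 Literature.NumberTheory.EllipticCurves.IwasawaDual
  Literature.NumberTheory.EllipticCurves.Castella2018.AcSelmer
  Literature.NumberTheory.IwasawaTheory Literature.NumberTheory.IwasawaTheory.Greenberg2016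
  Literature.NumberTheory.IwasawaTheory.Greenberg2006
  Summit.BirchSwinnertonDyer.BirchSwinnertonDyer.Theorems.GreenbergFullAtSelmer
  Summit.BirchSwinnertonDyer.BirchSwinnertonDyer.Theorems.AcTwistDeformationResidualPair
  Summit.BirchSwinnertonDyer.BirchSwinnertonDyer.Theorems.AcTwistDeformation
  Summit.BirchSwinnertonDyer.BirchSwinnertonDyer.Theorems.WeakLeopoldtAbove
  Summit.BirchSwinnertonDyer.BirchSwinnertonDyer.Theorems.WeakLeopoldtAboveOfSqueeze

namespace Summit.BirchSwinnertonDyer.BirchSwinnertonDyer.Theorems.WeakLeopoldtAboveCurve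

section Model

variable {K : Type} [Field K] [NumberField K] {S : Set (HeightOneSpectrum (𝓞 K))} {p : ℕ} [Fact p.Prime]
  (W : WeierstrassCurve K) [W.IsElliptic]
  [TopologicalSpace (PowerSeries ℤ_[p])] [IsTopologicalRing (PowerSeries ℤ_[p])]
  [IsTopologicalAddGroup (BigRepModule ℤ_[p] p (PrimaryTorsion W.geomPoints p))]
  [ContinuousSMul (PowerSeries ℤ_[p]) (BigRepModule ℤ_[p] p (PrimaryTorsion W.geomPoints p))]
  [ContinuousSMul ℤ_[p] (PrimaryTorsion W.geomPoints p)]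
  (hS : ∀ v : HeightOneSpectrum (𝓞 K), ((p : ℕ) : 𝓞 K) ∈ v.asIdeal → v ∈ S)
  (κ : ZpExtension K p) (ρ₀ : ContinuousRep (GaloisGroupUnramifiedOutside K S) ℤ_[p] (PrimaryTorsion W.geomPoints p))

/-- **[T28b `OfTateTC` re-typing: Greenberg 2006 Prop. 3.2 by name ↦ Milne ADT I Thm. 5.1 by name AT TOTALLY COMPLEX FIELDS (Prop. 3.2 is read in degrees ≤ 2 and at totally complex fields only, `prop32_global_le_two_of_tate_tc`).]** [cite: MilneADT2006, I Thm. 5.1 (p. 67)] **WL_f above `K_∞` at the model, from `corank_Λ S_{𝓛_𝔭}(K, 𝐃_E) = 0` and the published facts by name**: for `W/K` elliptic,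
`K` imaginary quadratic, `p = 𝔭𝔭̄` split, `S ⊇ {w ∣ p}` finite with a `σ`-supply (`κ(σ_w) ≠ 1` for some `σ_w ∈ Γ_{K_w}`, each
`w ∈ S`), ANY continuous `ℤ_p`-linear `ρ₀` of `G_{K,S}` on `E[p^∞] = PrimaryTorsion E(K̄) p`, Greenberg 2006 Props. 4.1, 4.2, §5 A,
3.2 and `cd_p(G_{K,Σ}) ≤ 2` BY NAME, `p ≠ 2`, and `corank_Λ S_{𝓛_𝔭}(K, 𝐃_E) = 0`:
`Subsingleton ((ρ₀.restrict (galoisGroupAboveSubtype S κ.kerSubgroup)).H 2)`. (w3 g3's `primaryTorsion_leo_h2_ofTateTC` gives corank `0` of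
`H²(K_Σ/K, 𝐃_E)`; cofreeness by `exists_dualBases_primaryTorsion` + `isCofree_bigRepModule_pi`; then this seat's
`subsingleton_H_two_above_of_facts_ofTateTC`.) [cite: Greenberg2006, Thm. 3 p. 342, Props. 4.1–4.2, §5 A, Props. 3.2–3.6]
[cite: Greenberg2016Selmer, §2.2–2.3, §4.3 pp. 20–21] [cite: NeukirchSchmidtWingberg2008, (8.3.18)] -/
theorem subsingleton_H_two_above_primaryTorsion_ofTateTC (hCD2 : groupCdLE_two_galoisGroupUnramifiedOutside K)
    (h41 : prop41_globalEulerPoincareCorank) (h42 : prop42_localEulerPoincareCorank)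
    (h5A : sec5A_localH2_subsingleton_of_LOC1) (h32 : (∀ (L : Type) [Field L] [NumberField L] [IsTotallyComplex L], Literature.NumberTheory.GaloisCohomology.tateGlobalEulerPoincareCharacteristic L)) (hp2 : p ≠ 2)
    (hSf : S.Finite) (hK : IsImaginaryQuadratic K)
    (hsup : ∀ v : HeightOneSpectrum (𝓞 K), v ∈ S →
      ∃ σ : absoluteGaloisGroup (Place.Completion (Sum.inr v : Place K)), κ (absGaloisRestrict K _ σ) ≠ 1)
    {𝔭 𝔭bar : HeightOneSpectrum (𝓞 K)} (hne : 𝔭bar ≠ 𝔭)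
    (hp𝔭 : ((p : ℕ) : 𝓞 K) ∈ 𝔭.asIdeal) (hp𝔭bar : ((p : ℕ) : 𝓞 K) ∈ 𝔭bar.asIdeal)
    (hSel : HasCorank (PowerSeries ℤ_[p])
      (fullAtSpecification S (bigRep (κ.liftUnramifiedOutside S hS) ρ₀) (Sum.inr 𝔭)).selmer 0) :
    Subsingleton ((ρ₀.restrict (galoisGroupAboveSubtype S κ.kerSubgroup)).H 2) := by
  haveI : IsTotallyComplex K := hK.2
  obtain ⟨hA, jQ, -, hinjQ, hsurjQ, -, -⟩ := exists_dualBases_primaryTorsion W p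
  have hcf : IsCofree (PowerSeries ℤ_[p]) (BigRepModule ℤ_[p] p (PrimaryTorsion W.geomPoints p)) :=
    isCofree_bigRepModule_pi hA jQ hinjQ hsurjQ
  have h0 : HasCorank (PowerSeries ℤ_[p]) ((bigRep (κ.liftUnramifiedOutside S hS) ρ₀).H 2) 0 :=
    (primaryTorsion_leo_h2_ofTateTC W hS κ ρ₀ h41 h42 h5A h32 hSf hK hsup hne hp𝔭 hp𝔭bar hSel).2.2.2
  have hA' : ∀ a : PrimaryTorsion W.geomPoints p, ∃ m : ℕ, (p ^ m : ℤ) • a = 0 :=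
    fun a ↦ exists_zpow_smul_eq_zero_of_nat (hA a)
  exact subsingleton_H_two_above_of_facts_ofTateTC S hS κ ρ₀ hCD2 h32 hp2 hSf hA' hcf h0

end Model

section Crux

variable {K : Type} [Field K] [NumberField K] {p : ℕ} [Fact p.Prime]

/-- **[T28b `OfTateTC` re-typing: Greenberg 2006 Prop. 3.2 by name ↦ Milne ADT I Thm. 5.1 by name AT TOTALLY COMPLEX FIELDS (Prop. 3.2 is read in degrees ≤ 2 and at totally complex fields only, `prop32_global_le_two_of_tate_tc`).]** [cite: MilneADT2006, I Thm. 5.1 (p. 67)] **WL_f for every descent of `E_K[p^∞]` to `G_{K,S}`, general `S`.** For `E = W/ℚ` base-changed to the imaginary quadratic `K`,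
`2 < p = v v̄` split, `κ` anticyclotomic with topological generator `γ`, a residual pair `θsub, θquot` of `E[p]` over `K`, `Sf` = the
places over `N_E` with the `Sf`-imprimitive cotorsion of the two characters (`hSsub`, `hSquot` — [PWL-θ]'s first clause), a FINITE
`S ⊇ {v, v̄} ∪ Sf` with a `σ`-supply (`κ(σ_w) ≠ 1`, `σ_w ∈ Γ_{K_w}`, each `w ∈ S`), and Greenberg 2006 Props. 4.1, 4.2, §5 A, 3.2 +
`cd_p(G_{K,S}) ≤ 2` BY NAME: for EVERY continuous representation `ρM` of `G_{K,S}` (any coefficient ring) on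
`E_K[p^∞] = ↥((W.baseChange K).geomPrimaryTorsion p)` descending the `Γ_K`-action, `H²(Gal(K_S/K_∞), E_K[p^∞]) = 0`. Ingredients
as in w3 g3's `…CurveSurAtVbar`: the Néron–Ogg–Shafarevich model `ρ₀` (`exists_continuousRep_primaryTorsion`), `hSel` from the
cotorsion of `X_ac` (`Thm141TorsionClauses…` + `hasCorank_fullAtSelmer_zero_of_xAc`), §2, and the bridge along
`PrimaryTorsion E_K(K̄) p = E_K[p^∞]`. [cite: Greenberg2006, Thm. 3 p. 342, Props. 4.1–4.2, §5 A, Props. 3.2–3.6]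
[cite: Castella2018, §2.2 Def. 2.2] [cite: KellerYin2024, Thm. 1.4.1, §1.4] [cite: NeukirchSchmidtWingberg2008, (8.3.18)] -/
theorem subsingleton_H_two_above_geomPrimaryTorsion_of_supply_ofTateTC (hCD2 : groupCdLE_two_galoisGroupUnramifiedOutside K)
    (h41 : prop41_globalEulerPoincareCorank) (h42 : prop42_localEulerPoincareCorank)
    (h5A : sec5A_localH2_subsingleton_of_LOC1) (h32 : (∀ (L : Type) [Field L] [NumberField L] [IsTotallyComplex L], Literature.NumberTheory.GaloisCohomology.tateGlobalEulerPoincareCharacteristic L))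
    (W : WeierstrassCurve ℚ) [W.IsElliptic] (hp : 2 < p) (hK : IsImaginaryQuadratic K)
    {v vbar : HeightOneSpectrum (𝓞 K)} (hv : ((p : ℕ) : 𝓞 K) ∈ v.asIdeal)
    (hvbar : ((p : ℕ) : 𝓞 K) ∈ vbar.asIdeal) (hne : vbar ≠ v)
    (κ : ZpExtension K p) (hκ : κ.IsAnticyclotomic) (γ : absoluteGaloisGroup K) [Fact (κ.IsTopGenerator γ)]
    {θsub θquot : FramedGaloisRep K (padicCoeffIntegers (∅ : Set (PadicAlgCl p))) 1}
    (hpair : IsResidualPairOver (W.baseChange K) p θsub θquot)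
    (Sf : Finset (HeightOneSpectrum (𝓞 K)))
    (hSf : ∀ w : HeightOneSpectrum (𝓞 K), w ∈ Sf ↔ ((W.conductorNorm ℤ : ℤ) : 𝓞 K) ∈ w.asIdeal)
    (hSsub : ∀ D : DatumDualData κ γ (charModule (∅ : Set (PadicAlgCl p)) θsub)
      (bdpData (charModule (∅ : Set (PadicAlgCl p)) θsub) p vbar) (↑Sf : Set (HeightOneSpectrum (𝓞 K))),
      Module.Finite (IwasawaAlgebra p) D.X ∧ Module.IsTorsion (IwasawaAlgebra p) D.X ∧ muInvariant p D.X = 0)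
    (hSquot : ∀ D : DatumDualData κ γ (charModule (∅ : Set (PadicAlgCl p)) θquot)
      (bdpData (charModule (∅ : Set (PadicAlgCl p)) θquot) p vbar) (↑Sf : Set (HeightOneSpectrum (𝓞 K))),
      Module.Finite (IwasawaAlgebra p) D.X ∧ Module.IsTorsion (IwasawaAlgebra p) D.X ∧ muInvariant p D.X = 0)
    (S : Set (HeightOneSpectrum (𝓞 K))) (hSfin : S.Finite)
    (hS : ∀ w : HeightOneSpectrum (𝓞 K), ((p : ℕ) : 𝓞 K) ∈ w.asIdeal → w ∈ S) (hSfS : ∀ w ∈ Sf, w ∈ S)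
    (hsup : ∀ w : HeightOneSpectrum (𝓞 K), w ∈ S →
      ∃ σ : absoluteGaloisGroup (Place.Completion (Sum.inr w : Place K)), κ (absGaloisRestrict K _ σ) ≠ 1)
    {R : Type} [CommRing R] [TopologicalSpace R] [Module R ↥((W.baseChange K).geomPrimaryTorsion p)]
    [ContinuousSMul R ↥((W.baseChange K).geomPrimaryTorsion p)]
    (ρM : ContinuousRep (GaloisGroupUnramifiedOutside K S) R ↥((W.baseChange K).geomPrimaryTorsion p))
    (hρM : ∀ (σ : absoluteGaloisGroup K) (P : ↥((W.baseChange K).geomPrimaryTorsion p)),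
      ρM (toUnramifiedQuot K S σ) P = σ • P) :
    Subsingleton ((ρM.restrict (galoisGroupAboveSubtype S κ.kerSubgroup)).H 2) := by
  haveI hEK : (W.baseChange K).IsElliptic := inferInstanceAs (W.map (algebraMap ℚ K)).IsElliptic
  -- good reduction off `S`
  have hgoodN : ∀ w : HeightOneSpectrum (𝓞 K), w ∉ Sf → (W.baseChange K).HasGoodReductionAt w := fun w hw ↦
    EisensteinPrimesMuLambda.hasGoodReductionAt_baseChange_of_conductorNorm_notMem W w fun h ↦ hw ((hSf w).mpr h)
  have hSbad : ∀ w : HeightOneSpectrum (𝓞 K), ¬ (W.baseChange K).HasGoodReductionAt w → w ∈ S :=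
    fun w hw ↦ hSfS w (by_contra fun hw' ↦ hw (hgoodN w hw'))
  have hgood : ∀ w : HeightOneSpectrum (𝓞 K), w ∉ S → ((p : ℕ) : 𝓞 K) ∉ w.asIdeal →
      (W.baseChange K).HasGoodReductionAt w := fun w hw _ ↦ hgoodN w fun h ↦ hw (hSfS w h)
  -- the model `ρ₀` of `E_K[p^∞]` over `G_{K,S}` (Néron–Ogg–Shafarevich)
  have hNS : ∀ n ∈ ramificationSubgroup K S, ∀ P : PrimaryTorsion (W.baseChange K).geomPoints p, n • P = P :=
    fun n hn P ↦ SignedBaseChangeAcDivCurveModel.smul_primaryTorsion_eq_of_mem_ramificationSubgroup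
      (W.baseChange K) p S hSbad hS hn P
  obtain ⟨ρ₀, hρ₀⟩ := SignedBaseChangeAcDivCurveModel.exists_continuousRep_primaryTorsion (W.baseChange K) p S hNS
  -- the canonical (discrete) topological instances of the arena
  letI tΛ : TopologicalSpace (PowerSeries ℤ_[p]) := ⊥
  haveI : DiscreteTopology (PowerSeries ℤ_[p]) := ⟨rfl⟩
  haveI : IsTopologicalRing (PowerSeries ℤ_[p]) := inferInstance
  haveI : IsTopologicalAddGroup (BigRepModule ℤ_[p] p (PrimaryTorsion (W.baseChange K).geomPoints p)) :=
    inferInstance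
  haveI : ContinuousSMul (PowerSeries ℤ_[p]) (BigRepModule ℤ_[p] p (PrimaryTorsion (W.baseChange K).geomPoints p)) :=
    inferInstance
  haveI : ContinuousSMul ℤ_[p] (PrimaryTorsion (W.baseChange K).geomPoints p) := continuousSMul_primaryTorsion
  -- `K` imaginary quadratic; `corank_Λ S_{𝓛_v}(K, 𝐃_E) = 0` from the cotorsion of `X_ac`
  haveI := hK.2
  have hKc : ∀ w : InfinitePlace K, w.IsComplex := IsTotallyComplex.isComplex
  obtain ⟨-, hXfin, hXtor, -⟩ :=
    Thm141TorsionClauses.moduleFinite_isTorsion_muInvariant_eq_zero_of_forall_dualData W hp K hK vbar hvbar κ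
      hκ γ hpair Sf hSf hSsub hSquot
  obtain ⟨hSel, -⟩ := hasCorank_fullAtSelmer_zero_of_xAc S (W.baseChange K) hS κ ρ₀ hρ₀ hKc hv hvbar hne
    hgood hXfin hXtor
  -- WL_f at the model
  have hA : Subsingleton ((ρ₀.restrict (galoisGroupAboveSubtype S κ.kerSubgroup)).H 2) :=
    subsingleton_H_two_above_primaryTorsion_ofTateTC (W.baseChange K) hS κ ρ₀ hCD2 h41 h42 h5A h32 hp.ne' hSfin hK hsup hne hv hvbar
      hSel
  -- transport along the identity `PrimaryTorsion E_K(K̄) p = E_K[p^∞]` (both discrete)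
  let η : PrimaryTorsion (W.baseChange K).geomPoints p ≃ₜ+ ↥((W.baseChange K).geomPrimaryTorsion p) :=
    { AddEquiv.refl (PrimaryTorsion (W.baseChange K).geomPoints p) with
      continuous_toFun := continuous_of_discreteTopology
      continuous_invFun := continuous_of_discreteTopology }
  have hη : ∀ (g : GaloisGroupUnramifiedOutside K S) (a : PrimaryTorsion (W.baseChange K).geomPoints p),
      η (ρ₀ g a) = ρM g (η a) := fun g a ↦ by
    obtain ⟨σ, rfl⟩ := toUnramifiedQuot_surjective K S g
    rw [hρ₀, hρM]
    rfl
  exact (subsingleton_H_restrict_iff_of_continuousAddEquiv ρ₀ ρM η hη _ 2).mp hA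

/-- **[T28b `OfTateTC` re-typing: Greenberg 2006 Prop. 3.2 by name ↦ Milne ADT I Thm. 5.1 by name AT TOTALLY COMPLEX FIELDS (Prop. 3.2 is read in degrees ≤ 2 and at totally complex fields only, `prop32_global_le_two_of_tate_tc`).]** [cite: MilneADT2006, I Thm. 5.1 (p. 67)] **WL_f IN THE CRUX'S BINDERS** (`Σ = {v, v̄} ∪ Sf`, `v` through `ι`, (Heeg) for `N_E`): for EVERY continuous representation `ρM`
of `G_{K,Σ}` (any coefficient ring) on `E_K[p^∞] = ↥((W.baseChange K).geomPrimaryTorsion p)` which DESCENDS the `Γ_K`-action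
(`ρM (toUnramifiedQuot K Σ σ) P = σ • P`), **`H²(Gal(K_Σ/K_∞), E_K[p^∞]) = 0`**:
`Subsingleton ((ρM.restrict (galoisGroupAboveSubtype Σ κ.kerSubgroup)).H 2)` — GRANTED Greenberg 2006 Props. 4.1, 4.2, §5 A, 3.2
and `cd_p(G_{K,Σ}) ≤ 2` BY NAME and the `Sf`-imprimitive cotorsion of the two residual characters. The `σ`-supply on `Σ` is
`exists_local_apply_ne_one_of_mem_insert_insert` (class field theory above `p`, Brink at `Sf`). This is the WL_f hypothesis of
w4 g4's `H2Bookkeeping.natCard_H2bookkeeping_of_groupCdLE` at `A_f = E[p^∞]`.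
[cite: Greenberg2006, Thm. 3 p. 342, Props. 4.1–4.2, §5 A, Props. 3.2–3.6] [cite: Castella2018, §2.2 Def. 2.2]
[cite: KellerYin2024, Thm. 1.4.1, §1.4 (arXiv:2402.12781v2 TeX L1183–1330)] [cite: NeukirchSchmidtWingberg2008, (8.3.18)]
[cite: Brink2007, Thm. 2] -/
theorem subsingleton_H_two_above_geomPrimaryTorsion_ofTateTC (hCD2 : groupCdLE_two_galoisGroupUnramifiedOutside K)
    (h41 : prop41_globalEulerPoincareCorank) (h42 : prop42_localEulerPoincareCorank)
    (h5A : sec5A_localH2_subsingleton_of_LOC1) (h32 : (∀ (L : Type) [Field L] [NumberField L] [IsTotallyComplex L], Literature.NumberTheory.GaloisCohomology.tateGlobalEulerPoincareCharacteristic L))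
    (W : WeierstrassCurve ℚ) [W.IsElliptic] (hp : 2 < p) (hK : IsImaginaryQuadratic K)
    (hH : SatisfiesHeegnerHypothesis (W.conductorNorm ℤ) K)
    {ι : K →+* ℚ_[p]} {v vbar : HeightOneSpectrum (𝓞 K)}
    (hvι : ∀ x : 𝓞 K, x ∈ v.asIdeal ↔ ‖ι (x : K)‖ < 1)
    (hvbar : ((p : ℕ) : 𝓞 K) ∈ vbar.asIdeal) (hne : vbar ≠ v)
    (κ : ZpExtension K p) (hκ : κ.IsAnticyclotomic) (γ : absoluteGaloisGroup K) [Fact (κ.IsTopGenerator γ)]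
    {θsub θquot : FramedGaloisRep K (padicCoeffIntegers (∅ : Set (PadicAlgCl p))) 1}
    (hpair : IsResidualPairOver (W.baseChange K) p θsub θquot)
    (Sf : Finset (HeightOneSpectrum (𝓞 K)))
    (hSf : ∀ w : HeightOneSpectrum (𝓞 K), w ∈ Sf ↔ ((W.conductorNorm ℤ : ℤ) : 𝓞 K) ∈ w.asIdeal)
    (hSsub : ∀ D : DatumDualData κ γ (charModule (∅ : Set (PadicAlgCl p)) θsub)
      (bdpData (charModule (∅ : Set (PadicAlgCl p)) θsub) p vbar) (↑Sf : Set (HeightOneSpectrum (𝓞 K))),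
      Module.Finite (IwasawaAlgebra p) D.X ∧ Module.IsTorsion (IwasawaAlgebra p) D.X ∧ muInvariant p D.X = 0)
    (hSquot : ∀ D : DatumDualData κ γ (charModule (∅ : Set (PadicAlgCl p)) θquot)
      (bdpData (charModule (∅ : Set (PadicAlgCl p)) θquot) p vbar) (↑Sf : Set (HeightOneSpectrum (𝓞 K))),
      Module.Finite (IwasawaAlgebra p) D.X ∧ Module.IsTorsion (IwasawaAlgebra p) D.X ∧ muInvariant p D.X = 0)
    {R : Type} [CommRing R] [TopologicalSpace R] [Module R ↥((W.baseChange K).geomPrimaryTorsion p)]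
    [ContinuousSMul R ↥((W.baseChange K).geomPrimaryTorsion p)]
    (ρM : ContinuousRep (GaloisGroupUnramifiedOutside K (↑(insert v (insert vbar Sf)) : Set (HeightOneSpectrum (𝓞 K))))
      R ↥((W.baseChange K).geomPrimaryTorsion p))
    (hρM : ∀ (σ : absoluteGaloisGroup K) (P : ↥((W.baseChange K).geomPrimaryTorsion p)),
      ρM (toUnramifiedQuot K _ σ) P = σ • P) :
    Subsingleton ((ρM.restrict
      (galoisGroupAboveSubtype (↑(insert v (insert vbar Sf)) : Set (HeightOneSpectrum (𝓞 K))) κ.kerSubgroup)).H 2) := by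
  have hv : ((p : ℕ) : 𝓞 K) ∈ v.asIdeal := IwasawaTwoVariable.natCast_mem_asIdeal_of_norm_iff hvι
  have hS : ∀ w : HeightOneSpectrum (𝓞 K), ((p : ℕ) : 𝓞 K) ∈ w.asIdeal →
      w ∈ (↑(insert v (insert vbar Sf)) : Set (HeightOneSpectrum (𝓞 K))) :=
    mem_insert_insert_of_natCast_mem hK hv hvbar hne Sf
  have hSfS : ∀ w ∈ Sf, w ∈ (↑(insert v (insert vbar Sf)) : Set (HeightOneSpectrum (𝓞 K))) := fun w hw ↦ by
    rw [Finset.coe_insert, Finset.coe_insert]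
    exact Or.inr (Or.inr (Finset.mem_coe.mpr hw))
  exact subsingleton_H_two_above_geomPrimaryTorsion_of_supply_ofTateTC hCD2 h41 h42 h5A h32 W hp hK hv hvbar hne κ hκ γ hpair Sf hSf
    hSsub hSquot _ (Finset.finite_toSet _) hS hSfS (exists_local_apply_ne_one_of_mem_insert_insert hK hp hH κ hκ hv hvbar Sf hSf)
    ρM hρM

end Crux

end Summit.BirchSwinnertonDyer.BirchSwinnertonDyer.Theorems.WeakLeopoldtAboveCurve

end
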